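import Mathlib
import Summits.ResolutionOfSingularities.ResolutionOfSingularities.Theorems.WeightedInvariantLocalWeightedDropWildPurePowerFlagDropSplit
import Summits.ResolutionOfSingularities.ResolutionOfSingularities.Theorems.WeightedInvariantLocalWeightedDropWildPurePowerFlagInvN1
import Summits.ResolutionOfSingularities.ResolutionOfSingularities.Theorems.WeightedInvariantLocalWeightedDropWildPurePowerFlagDropZeroShape

/-!
# `WeightedInvariant.LocalWeightedDrop`, line `hasse-ridge-face-selection`, piece S3πM: ASSEMBLY of `DropZeroStatement` ([HP24, Prop. 4] at
# an axis point) from its case pieces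

Crux item stmt-ResolutionOfSingularities-8899 `LocalWeightedDrop` (route `ResolutionOfSingularities/WeightedInvariant`), serving the
door `WeightedConstruction` stmt-ResolutionOfSingularities-0571.  [OURS · L1 W4.3, chain w43, stub worker 1 (gen 3).  Not a statement of
any manuscript.  Printed source of the case list: H. Hauser, S. Perlega, PRIMS **60** (2024), Prop. 4 proof p. 794 l. 9–21, cases (i), (iii),
(iv) with `t = 0`.]

`dropZeroStatement_of_pieces`: `DropZeroStatement p e k` (`…WildPurePowerFlagDropSplit`) follows from three sub-statements, one per
remaining configuration of a child flag `(o, g)` at the axis successor `x^q·T = B(x, xy)`: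
* (γ₁) `o = false`, `n = 0`, companion branch `d_res(B) < q` of the parent;
* (γ₂) `o = true`, `n = 0`, companion branch `d_res(B) < q`;
* (iv₀) `o = true`, tangency `≥ 2`: the kangaroo case (iv) at `t = 0`;
the other configurations being discharged by stub worker 6's DropZeroStatement-shaped lemmas of `…FlagDropZeroShape` (parent-hypothesis
free, first-orientation witnesses): `exists_flag_gt_of_isN0_stepZero` ((i), both boundary cases, `d_res ≥ q`), `exists_flag_gt_of_isN0_swap_stepZero`
(the new exceptional curve `V(x′)`, `d_res ≥ q`), `exists_flag_gt_of_isTangent_stepZero` ((iii)); and the second-orientation datum of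
tangency `1` by `flagTriple_swap_of_tangency_one` (same triple as a first-orientation tangent datum) followed by (iii).
-/

set_option linter.dupNamespace false -- mandated namespace of this single-conjunct summit

namespace Summit.ResolutionOfSingularities.ResolutionOfSingularities.Theorems

open Literature.AlgebraicGeometry.Resolution
open Literature.AlgebraicGeometry.Resolution.HauserPerlega2024

namespace PurePowerFlag

open MvPowerSeries

variable {k : Type} [Field k]

/-- **`DropZeroStatement` FROM ITS CASE PIECES.**  The four hypotheses are the sub-statements (α), (β), (γ), (iv₀) of the module docstring,
each in the shape of `DropZeroStatement` restricted to its configuration (parent clean, non-zero, `q < ord`; child a non-terminal position). -/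
theorem dropZeroStatement_of_pieces (p : ℕ) [Fact p.Prime] (k : Type) [Field k] [CharP k p] (e : ℕ)
    (hγ₁ : ∀ (B : MvPowerSeries (Fin 2) k) (E : Finset (Fin 2)) (T : MvPowerSeries (Fin 2) k),
      cleanSeries (p ^ e) B = B → B ≠ 0 → ((p ^ e : ℕ) : ℕ∞) < B.order →
      X 0 ^ (p ^ e) * T = subst (PlaneGerm.dirChart (0 : k)) B →
      ((p ^ e : ℕ) : ℕ∞) < T.order → ¬ TermSub (p ^ e) T → dRes B E < p ^ e →
      ∀ g : PowerSeries k, PowerSeries.constantCoeff g = 0 → IsN0 (succE (0 : k) E) g →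
        ∃ f : PowerSeries k, PowerSeries.constantCoeff f = 0 ∧ (IsN0 E f ∨ IsTangent E f) ∧
          flagTriple (p ^ e) T (succE (0 : k) E) g < flagTriple (p ^ e) B E f)
    (hγ₂ : ∀ (B : MvPowerSeries (Fin 2) k) (E : Finset (Fin 2)) (T : MvPowerSeries (Fin 2) k),
      cleanSeries (p ^ e) B = B → B ≠ 0 → ((p ^ e : ℕ) : ℕ∞) < B.order →
      X 0 ^ (p ^ e) * T = subst (PlaneGerm.dirChart (0 : k)) B →
      ((p ^ e : ℕ) : ℕ∞) < T.order → ¬ TermSub (p ^ e) T → dRes B E < p ^ e →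
      ∀ g : PowerSeries k, PowerSeries.constantCoeff g = 0 → IsN0 (swapE (succE (0 : k) E)) g →
        ∃ f : PowerSeries k, PowerSeries.constantCoeff f = 0 ∧ (IsN0 E f ∨ IsTangent E f) ∧
          flagTriple (p ^ e) (swap T) (swapE (succE (0 : k) E)) g < flagTriple (p ^ e) B E f)
    (hiv : ∀ (B : MvPowerSeries (Fin 2) k) (E : Finset (Fin 2)) (T : MvPowerSeries (Fin 2) k),
      cleanSeries (p ^ e) B = B → B ≠ 0 → ((p ^ e : ℕ) : ℕ∞) < B.order →
      X 0 ^ (p ^ e) * T = subst (PlaneGerm.dirChart (0 : k)) B →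
      ((p ^ e : ℕ) : ℕ∞) < T.order → ¬ TermSub (p ^ e) T →
      ∀ g : PowerSeries k, PowerSeries.constantCoeff g = 0 → IsTangent (swapE (succE (0 : k) E)) g → 2 ≤ tangency g →
        ∃ f : PowerSeries k, PowerSeries.constantCoeff f = 0 ∧ (IsN0 E f ∨ IsTangent E f) ∧
          flagTriple (p ^ e) (swap T) (swapE (succE (0 : k) E)) g < flagTriple (p ^ e) B E f) :
    DropZeroStatement p e k := by
  intro B E T hB hB0 hBord hT hTord hnT o g hg hadm
  set q := p ^ e with hq
  have hqo : ((q : ℕ) : ℕ∞) ≤ B.order := hBord.le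
  have hTclean : cleanSeries q T = T := cleanSeries_of_stepZero q hB hT
  rw [hTclean] at hTord hnT ⊢
  have hT0 : T ≠ 0 := ne_zero_stepZero q hB0 hT
  cases o
  · -- first orientation: curve `V(y′ + g(x′))`
    simp only [orient_false, orientE_false] at hadm ⊢
    rcases hadm with hN0 | hTan
    · by_cases hd : q ≤ dRes B E
      · -- (i), `d_res ≥ q` (both boundary cases)
        exact exists_flag_gt_of_isN0_stepZero p hB hB0 hqo hT (zero_mem_succE_zero E) (one_mem_succE_zero_iff E) hd hnT g hg hN0
      · -- (γ₁): companion branch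
        exact hγ₁ B E T hB hB0 hBord hT hTord hnT (not_le.mp hd) g hg hN0
    · -- (iii): a tangent flag of the child lifts to `X·g`
      exact exists_flag_gt_of_isTangent_stepZero q hT (one_mem_succE_zero_iff E) g hg hTan
  · -- second orientation: curve `V(x′ + g(y′))`
    simp only [orient_true, orientE_true] at hadm ⊢
    rcases hadm with hN0 | hTan
    · by_cases hd : q ≤ dRes B E
      · exact exists_flag_gt_of_isN0_swap_stepZero q (Nat.one_le_pow _ _ (Fact.out : p.Prime).pos) hB hB0 hqo hT
          (zero_mem_succE_zero E) (one_mem_succE_zero_iff E) hd g hN0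
      · exact hγ₂ B E T hB hB0 hBord hT hTord hnT (not_le.mp hd) g hg hN0
    · by_cases htg : 2 ≤ tangency g
      · exact hiv B E T hB hB0 hBord hT hTord hnT g hg hTan htg
      · -- tangency `1`: the same curve in the first orientation, then (iii)
        have hone : tangency g = 1 := by
          have := one_le_tangency hg hTan.2.1; omega
        have h1' : (1 : Fin 2) ∈ succE (0 : k) E := by
          have := hTan.2.2
          rcases this with h2 | h0
          · exfalso
            rw [tangency] at hone
            have hfin : g.order ≠ ⊤ := fun hh => hTan.2.1 (PowerSeries.order_eq_top.mp hh)
            rw [← ENat.coe_toNat hfin, hone] at h2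
            exact absurd (by exact_mod_cast h2 : (2 : ℕ) ≤ 1) (by omega)
          · rwa [mem_swapE, Equiv.swap_apply_left] at h0
        have h0' : (0 : Fin 2) ∈ succE (0 : k) E := zero_mem_succE_zero E
        obtain ⟨heq, hTanh⟩ := flagTriple_swap_of_tangency_one p e hT0 hTclean h0' h1' hg hone
        rw [heq]
        exact exists_flag_gt_of_isTangent_stepZero q hT (one_mem_succE_zero_iff E) _ (constantCoeff_linShift _) hTanh

end PurePowerFlag

end Summit.ResolutionOfSingularities.ResolutionOfSingularities.Theorems
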